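import Literature.MathematicalPhysics.QuantumLattice.HubbardJordanWigner
import Literature.MathematicalPhysics.QuantumLattice.InfVolFermionState
import Literature.MathematicalPhysics.QuantumLattice.SpinEmbedding
import HarnessLib

/-!
# Jordan–Wigner versus isotony: when the CAR embedding is the spin embedding

Topic `MathematicalPhysics/QuantumLattice`; namespace `Literature.MathematicalPhysics.QuantumLattice.JordanWigner`.
Everything in this file is a PROVED theorem; no definition and no named fact is introduced.

The tree has two "second quantisations" of an injection of sites `φ : Λ₁ ↪ Λ₂`:
the CAR one, `fermionEmbed φ : 𝔄^{CAR}_{Λ₁} →ₐ 𝔄^{CAR}_{Λ₂}` (`c_{xσ} ↦ c_{φx,σ}`, `InfVolFermionState` §1), and the spin one,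
`spinEmbed φ : Op Λ₁ q →ₐ Op Λ₂ q` (`A ↦ A ⊗ 𝟙`, `SpinEmbedding`); and it has the site-major Jordan–Wigner
identification `JordanWigner.toSpin : 𝔄^{CAR}_Λ ≃ₐ Op Λ 4` (`HubbardJordanWigner`: `c_{xσ} ↦ (⨂_{y<x} F_y) ⊗ (c_σ)_x`,
Essler–Frahm–Göhmann–Klümper–Korepin §12.3.4 (12.196)–(12.201)). This file records how the three interact:

* `spinEmbed_productOp`, `spinEmbed_jwString_of_isLowerSet` — bookkeeping: `Γ_φ` of a product operator, and of the
  Jordan–Wigner string when the image of `φ` is an initial segment (then no site outside the image lies below an image site,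
  so the string of `φ x` is the image of the string of `x`).
* **`toSpin_fermionEmbed_of_isLowerSet`** — for an ORDER embedding `φ` whose image is a LOWER set (an initial segment of the
  site order): `toSpin (Γ^{CAR}_φ A) = Γ^{spin}_φ (toSpin A)` for EVERY `A`. This is the statement that the Jordan–Wigner
  transformation is compatible with the inclusion of an initial block of sites — in Essler et al.'s words the string
  "runs over the sites preceding `j`" only (their eq. (12.198)–(12.201), site order reversed as recorded in
  `HubbardJordanWigner`), so operators of the first `ℓ` sites are mapped into `(ℂ⁴)^{⊗ℓ} ⊗ 𝟙`; equivalently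
  Bratteli–Robinson's remark that the Jordan–Wigner map identifies `𝔄^{CAR}(𝔥_{[1,n]})` with `⊗_{k ≤ n} M₂` COMPATIBLY with
  `n ↦ n + 1` (OAQSM 2, after Thm. 5.2.5 / eq. (5.2.13); OAQSM 1, Example 2.6.?? of the UHF presentation is not used).
  Proof: both sides are algebra homomorphisms out of the CAR matrix algebra agreeing on the generators (`algHom_ext_car`).
* `toSpin_parityOp`, **`toSpin_parityAut`** — the grading: `toSpin ((-1)^N) = ⨂_x F_x` and
  `toSpin (Θ A) = (⨂F) (toSpin A) (⨂F)` (Araki–Moriya §4.1 Def. 4.2: `Θ`; under Jordan–Wigner `Θ` is conjugation by the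
  product of all site parities, Essler et al. (12.198)).

The companion statement for a FINAL segment (upper set) holds on the EVEN subalgebra only and is the content of the sequel
file (the strings of the sites below the block do not cancel on odd elements). Consumers: the by-value transport of
translation-invariant fermionic SDP relaxations (`Summits/Ventures/CertifiedManyBodySolver/Transport`, lane B, where the window
density matrix of an even state must be shown locally translation invariant AS A MATRIX in the Jordan–Wigner product basis).

## References

* F. H. L. Essler, H. Frahm, F. Göhmann, A. Klümper, V. E. Korepin, *The One-Dimensional Hubbard Model*, CUP (2005),
  §12.3.4 eqs. (12.196)–(12.201). [cite: EsslerEtAl2005, §12.3.4 eqs. (12.196)–(12.201)]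
* O. Bratteli, D. W. Robinson, *Operator Algebras and Quantum Statistical Mechanics 2*, 2nd ed., §5.2.2 Thm. 5.2.5,
  eq. (5.2.13) and §6.2.1 (isotony of local algebras). [cite: BratteliRobinsonII1997, §5.2.2 Thm. 5.2.5]
* H. Araki, H. Moriya, Rev. Math. Phys. 15 (2003) 93, §4.1 Def. 4.1–4.3 (local CAR algebras, `Θ`, isotony).
  [cite: ArakiMoriya2003, §4.1 Def. 4.1–4.3]

## Tree / Mathlib search

Reused: `JordanWigner.toSpin`, `toSpin_apply`, `toSpin_annihilation`, `toSpin_creation`, `jwString`, `siteParity`,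
`config`, `card_config` (`HubbardJordanWigner`); `fermionEmbed`, `fermionEmbed_annihilation`, `fermionEmbed_creation`,
`algHom_ext_car`, `parityAut_apply` (`InfVolFermionState`); `parityOp` (`FermionOperators`); `spinEmbed`, `spinEmbed_apply`,
`spinEmbed_onSite` (`SpinEmbedding`); `productOp`, `productOp_apply`, `productOp_diagonal` (`ProductOperators`,
`HubbardJordanWigner`); `rangeSites` (`HubbardCouplingTransport`). Mathlib: `IsLowerSet`, `OrderEmbedding.lt_iff_lt`,
`Finset.prod_subset`, `Finset.prod_map`. `lean search 'toSpin_fermionEmbed|toSpin \(fermionEmbed|toSpin_parity'`: nothing.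
-/

noncomputable section

namespace Literature.MathematicalPhysics.QuantumLattice

open Matrix Finset HubbardWave0

namespace JordanWigner

/-! ### Spin-side bookkeeping: `Γ_φ` of product operators and of Jordan–Wigner strings -/

section SpinSide

variable {Λ₁ Λ₂ : Type*} [Fintype Λ₁] [DecidableEq Λ₁] [Fintype Λ₂] [DecidableEq Λ₂] {q : ℕ}

/-- **`Γ_φ (⨂_x v_{φx}) = ⨂_z v_z`** when the family `v` is the identity off the image of `φ`: the spin embedding of a
product operator is the product operator extended by `𝟙`. [cite: BratteliRobinsonII1997, §6.2.1] -/
theorem spinEmbed_productOp (φ : Λ₁ ↪ Λ₂) (v : Λ₂ → Matrix (Fin q) (Fin q) ℂ)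
    (hv : ∀ z, z ∉ Set.range φ → v z = 1) :
    spinEmbed φ (productOp fun x => v (φ x)) = productOp v := by
  ext σ τ
  rw [spinEmbed_apply, productOp_apply]
  by_cases h : ∀ y, y ∉ Set.range φ → σ y = τ y
  · rw [if_pos h, productOp_apply]
    have hsub : rangeSites φ ⊆ (Finset.univ : Finset Λ₂) := Finset.subset_univ _
    rw [← Finset.prod_subset hsub]
    · rw [rangeSites, Finset.prod_map]
    · intro z _ hz
      have hz' : z ∉ Set.range φ := by
        intro hzr
        obtain ⟨x, rfl⟩ := hzr
        exact hz (Finset.mem_map_of_mem φ (Finset.mem_univ x))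
      rw [hv z hz', h z hz', Matrix.one_apply_eq]
  · rw [if_neg h]
    push Not at h
    obtain ⟨z, hz, hne⟩ := h
    exact (Finset.prod_eq_zero (Finset.mem_univ z) (by rw [hv z hz, Matrix.one_apply_ne hne])).symm

end SpinSide

section Strings

variable {Λ₁ Λ₂ : Type*} [LinearOrder Λ₁] [Fintype Λ₁] [LinearOrder Λ₂] [Fintype Λ₂]

/-- **The string of an image site is the image of the string** when `φ` is an order embedding onto an initial segment
(a lower set): no site outside the image lies below an image site. [cite: EsslerEtAl2005, §12.3.4 eq. (12.198)] -/
theorem spinEmbed_jwString_of_isLowerSet (φ : Λ₁ ↪o Λ₂) (hφ : IsLowerSet (Set.range φ)) (x : Λ₁) :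
    spinEmbed φ.toEmbedding (jwString x) = jwString (φ x) := by
  set v : Λ₂ → Matrix (Fin 4) (Fin 4) ℂ := fun z => if z < φ x then siteParity else 1 with hvdef
  have hv : ∀ z, z ∉ Set.range φ.toEmbedding → v z = 1 := by
    intro z hz
    have hlt : ¬ z < φ x := fun hzx => hz (hφ hzx.le ⟨x, rfl⟩)
    simp only [hvdef, hlt, if_false]
  have hfam : (fun y : Λ₁ => if y < x then siteParity else (1 : Matrix (Fin 4) (Fin 4) ℂ)) =
      fun y => v (φ.toEmbedding y) := by
    funext y
    change (if y < x then siteParity else (1 : Matrix (Fin 4) (Fin 4) ℂ)) = if φ y < φ x then siteParity else 1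
    simp only [OrderEmbedding.lt_iff_lt]
  rw [jwString, jwString, hfam]
  exact spinEmbed_productOp φ.toEmbedding v hv

/-! ### Jordan–Wigner is compatible with the inclusion of an initial segment -/

/-- **Jordan–Wigner ∘ CAR-isotony = spin-isotony ∘ Jordan–Wigner on an initial segment.** For an order embedding
`φ : Λ₁ ↪o Λ₂` whose image is a lower set, `toSpin (Γ^{CAR}_φ A) = Γ^{spin}_φ (toSpin A)` for every `A` (the strings of the
image sites stay inside the image). [cite: EsslerEtAl2005, §12.3.4 eqs. (12.198)–(12.201)]
[cite: BratteliRobinsonII1997, §5.2.2 Thm. 5.2.5] -/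
theorem toSpin_fermionEmbed_of_isLowerSet (φ : Λ₁ ↪o Λ₂) (hφ : IsLowerSet (Set.range φ))
    (A : Matrix (Finset (Orb Λ₁)) (Finset (Orb Λ₁)) ℂ) :
    toSpin (fermionEmbed φ.toEmbedding A) = spinEmbed φ.toEmbedding (toSpin A) := by
  have key : ((toSpin (Λ := Λ₂)).toAlgHom).comp (fermionEmbed φ.toEmbedding) =
      (spinEmbed (q := 4) φ.toEmbedding).comp (toSpin (Λ := Λ₁)).toAlgHom := by
    refine algHom_ext_car (fun i => ?_) (fun i => ?_)
    · have hi : i = orb (ofLex i).1 (ofLex i).2 := rfl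
      rw [hi]
      change toSpin (fermionEmbed φ.toEmbedding (annihilation (orb (ofLex i).1 (ofLex i).2))) =
        spinEmbed φ.toEmbedding (toSpin (annihilation (orb (ofLex i).1 (ofLex i).2)))
      rw [fermionEmbed_annihilation, toSpin_annihilation, toSpin_annihilation, map_mul, spinEmbed_onSite,
        spinEmbed_jwString_of_isLowerSet φ hφ]
      rfl
    · have hi : i = orb (ofLex i).1 (ofLex i).2 := rfl
      rw [hi]
      change toSpin (fermionEmbed φ.toEmbedding (creation (orb (ofLex i).1 (ofLex i).2))) =
        spinEmbed φ.toEmbedding (toSpin (creation (orb (ofLex i).1 (ofLex i).2)))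
      rw [fermionEmbed_creation, toSpin_creation, toSpin_creation, map_mul, spinEmbed_onSite,
        spinEmbed_jwString_of_isLowerSet φ hφ]
      rfl
  exact congrArg (fun f : Matrix (Finset (Orb Λ₁)) (Finset (Orb Λ₁)) ℂ →ₐ[ℂ] Op Λ₂ 4 => f A) key

end Strings

/-! ### The grading under Jordan–Wigner -/

section Parity

variable {Λ : Type*} [LinearOrder Λ] [Fintype Λ]

/-- **`toSpin ((-1)^N) = ⨂_x F_x`**: the fermion parity is the product of the site parities `F = diag(1,-1,-1,1)`.
[cite: EsslerEtAl2005, §12.3.4 eq. (12.198)] -/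
theorem toSpin_parityOp :
    toSpin (parityOp : Matrix (Finset (Orb Λ)) (Finset (Orb Λ)) ℂ) = productOp fun _ : Λ => siteParity := by
  have h1 : (fun _ : Λ => siteParity) = fun _ : Λ => diagonal fun a : Fin 4 => (-1 : ℂ) ^ siteCharge a := by
    funext x
    rfl
  rw [h1, productOp_diagonal]
  ext k k'
  rw [toSpin_apply, parityOp, diagonal_apply, diagonal_apply]
  by_cases h : k = k'
  · subst h
    rw [if_pos rfl, if_pos rfl, card_config, Finset.prod_pow_eq_pow_sum]
  · have h' : config k ≠ config k' := fun hc => h (configEquiv.injective hc)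
    rw [if_neg h', if_neg h]

/-- **The even–odd automorphism under Jordan–Wigner**: `toSpin (Θ A) = (⨂F) · toSpin A · (⨂F)`.
[cite: ArakiMoriya2003, §4.1 Def. 4.2] [cite: EsslerEtAl2005, §12.3.4 eq. (12.198)] -/
theorem toSpin_parityAut (A : Matrix (Finset (Orb Λ)) (Finset (Orb Λ)) ℂ) :
    toSpin (parityAut A) =
      productOp (fun _ : Λ => siteParity) * toSpin A * productOp (fun _ : Λ => siteParity) := by
  rw [parityAut_apply, map_mul, map_mul, toSpin_parityOp]

/-- `(⨂F)² = 1`. [cite: EsslerEtAl2005, §12.3.4 eq. (12.198)] -/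
theorem productOp_siteParity_mul_self :
    productOp (fun _ : Λ => siteParity) * productOp (fun _ : Λ => siteParity) = (1 : Op Λ 4) := by
  rw [productOp_mul, ← productOp_one]
  congr 1
  funext x
  exact siteParity_mul_siteParity

/-- **Even elements have parity-even Jordan–Wigner images**: `Θ A = A` iff `(⨂F) (toSpin A) (⨂F) = toSpin A`.
[cite: ArakiMoriya2003, §4.1 Def. 4.2] -/
theorem parityAut_eq_self_iff (A : Matrix (Finset (Orb Λ)) (Finset (Orb Λ)) ℂ) :
    parityAut A = A ↔
      productOp (fun _ : Λ => siteParity) * toSpin A * productOp (fun _ : Λ => siteParity) = toSpin A := by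
  rw [← toSpin_parityAut]
  exact ⟨fun h => by rw [h], fun h => toSpin.injective h⟩

end Parity

end JordanWigner

end Literature.MathematicalPhysics.QuantumLattice
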